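import Mathlib

/-!
# V4U exit definitions: the presentation of the `⅓(1,1,2)` ring and its seven generator symbols

(crux stmt-ResolutionOfSingularities-15640 `WildQuotients.WildQuotientResolution`, line `Sketch`,
sector `|G| = p`; programme V4U of `L/w45c/CHAIN.md` v5 — the `μ₃`-exit downstairs (stub-4 FINDING
V4U-μ₃/μ₂-EXIT 2026-08-27T04:2xZ: over the `x_a`-vertex curve `C₀` the quotient piece is
`Spec R₃ × 𝔸^{n−3}`, `R₃ = k[y₁³, y₂³, y₃³, y₁²y₂, y₁y₂², y₁y₃, y₂y₃]` the invariant ring of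
`⅓(1,1,2)` — `(y₁,y₂,y₃) = (ρ, N, c′)` for `p ≡ 1 (3)` and `(N, c′, ρ)` for `p ≡ 2 (3)` — and ONE
blow-up of the ideal of the seven generators resolves it). [OURS · L1 W4.5c] — NOT a statement of
any manuscript; replaces the role of no printed item. Owner res-L1-w45c-stub-4.)

As for the `A₁`-cone of V3U (`ToricExit.conePresentation`), the ring is handled through a
PRESENTATION `k[Y] → k[x]` on the symbols `Y = Fin n ⊕ Fin 4` (`inl a, inl b, inl c ↦ y₁³, y₂³, y₃³`
with `yᵢ = X a, X b, X c`; `inl i ↦ X i` passengers; `inr 0, 1, 2, 3 ↦ y₁²y₂, y₁y₂², y₁y₃, y₂y₃`);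
the presented ring is `k[Y] ⧸ ker`, isomorphic to the image `R₃ ⊗ k[passengers]` by
`RingHom.quotientKerEquivRange` (no generators of the kernel are needed).

* `Third112.presentation k n a b c` — the presentation `k[Y] →ₐ[k] k[x]`.
* `Third112.gens k n a b c : Fin 7 → k[Y]` — the seven generator symbols, in the order
  `y₁³, y₂³, y₃³, y₁²y₂, y₁y₂², y₁y₃, y₂y₃` (Newton vertices `0, 1, 2, 5, 6`; edge points `3, 4`).
-/

-- single-problem summit: the doubled namespace component `ResolutionOfSingularities` is forced
set_option linter.dupNamespace false

noncomputable section

open MvPolynomial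

namespace Summit.ResolutionOfSingularities.ResolutionOfSingularities.Theorems.WildQuotientResolution.Third112

/-- The presentation `k[Y] → k[x]` of `R₃ ⊗ k[passengers]`, `Y = Fin n ⊕ Fin 4`:
`inl a ↦ (X a)³`, `inl b ↦ (X b)³`, `inl c ↦ (X c)³`, `inl i ↦ X i` otherwise,
`inr 0 ↦ (X a)² X b`, `inr 1 ↦ X a (X b)²`, `inr 2 ↦ X a X c`, `inr 3 ↦ X b X c`. [OURS · L1 W4.5c] -/
def presentation (k : Type) [Field k] (n : ℕ) (a b c : Fin n) :
    MvPolynomial (Fin n ⊕ Fin 4) k →ₐ[k] MvPolynomial (Fin n) k :=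
  MvPolynomial.aeval (Sum.elim
    (fun i => if i = a then X a ^ 3 else if i = b then X b ^ 3 else if i = c then X c ^ 3 else X i)
    (![X a ^ 2 * X b, X a * X b ^ 2, X a * X c, X b * X c] : Fin 4 → MvPolynomial (Fin n) k))

/-- The seven generator symbols `Y_{y₁³}, Y_{y₂³}, Y_{y₃³}, Y_{y₁²y₂}, Y_{y₁y₂²}, Y_{y₁y₃}, Y_{y₂y₃}`.
[OURS · L1 W4.5c] -/
def gens (k : Type) [Field k] (n : ℕ) (a b c : Fin n) : Fin 7 → MvPolynomial (Fin n ⊕ Fin 4) k :=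
  ![X (Sum.inl a), X (Sum.inl b), X (Sum.inl c), X (Sum.inr 0), X (Sum.inr 1), X (Sum.inr 2),
    X (Sum.inr 3)]

section Simp

variable (k : Type) [Field k] (n : ℕ) (a b c : Fin n)

/-- `Y_{inl a} ↦ y₁³`. [folklore] -/
theorem presentation_inl_a : presentation k n a b c (X (Sum.inl a)) = X a ^ 3 := by
  simp [presentation]

/-- `Y_{inl b} ↦ y₂³` (`a ≠ b`). [folklore] -/
theorem presentation_inl_b (hab : a ≠ b) : presentation k n a b c (X (Sum.inl b)) = X b ^ 3 := by
  simp [presentation, hab.symm]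

/-- `Y_{inl c} ↦ y₃³` (`a ≠ c`, `b ≠ c`). [folklore] -/
theorem presentation_inl_c (hac : a ≠ c) (hbc : b ≠ c) :
    presentation k n a b c (X (Sum.inl c)) = X c ^ 3 := by
  simp [presentation, hac.symm, hbc.symm]

/-- `Y_{inl i} ↦ X i` for a passenger `i ≠ a, b, c`. [folklore] -/
theorem presentation_inl_of_ne (i : Fin n) (hia : i ≠ a) (hib : i ≠ b) (hic : i ≠ c) :
    presentation k n a b c (X (Sum.inl i)) = X i := by
  simp [presentation, hia, hib, hic]

/-- `Y_{inr 0} ↦ y₁² y₂`. [folklore] -/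
theorem presentation_inr_zero : presentation k n a b c (X (Sum.inr 0)) = X a ^ 2 * X b := by
  simp [presentation]

/-- `Y_{inr 1} ↦ y₁ y₂²`. [folklore] -/
theorem presentation_inr_one : presentation k n a b c (X (Sum.inr 1)) = X a * X b ^ 2 := by
  simp [presentation]

/-- `Y_{inr 2} ↦ y₁ y₃`. [folklore] -/
theorem presentation_inr_two : presentation k n a b c (X (Sum.inr 2)) = X a * X c := by
  simp [presentation]

/-- `Y_{inr 3} ↦ y₂ y₃`. [folklore] -/
theorem presentation_inr_three : presentation k n a b c (X (Sum.inr 3)) = X b * X c := by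
  simp [presentation]

/-- The presentation on the seven generator symbols (`a, b, c` distinct). [folklore] -/
theorem presentation_gens (hab : a ≠ b) (hbc : b ≠ c) (hac : a ≠ c) (l : Fin 7) :
    presentation k n a b c (gens k n a b c l) =
      (![X a ^ 3, X b ^ 3, X c ^ 3, X a ^ 2 * X b, X a * X b ^ 2, X a * X c, X b * X c] :
        Fin 7 → MvPolynomial (Fin n) k) l := by
  fin_cases l
  · simpa [gens] using presentation_inl_a k n a b c
  · simpa [gens] using presentation_inl_b k n a b c hab
  · simpa [gens] using presentation_inl_c k n a b c hac hbc
  · simpa [gens] using presentation_inr_zero k n a b c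
  · simpa [gens] using presentation_inr_one k n a b c
  · simpa [gens] using presentation_inr_two k n a b c
  · simpa [gens] using presentation_inr_three k n a b c

end Simp

end Summit.ResolutionOfSingularities.ResolutionOfSingularities.Theorems.WildQuotientResolution.Third112

end
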